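import Summits.QuantumFields.YangMills.Theorems.BalabanLadderIRTwistedSlabWeitzenboeck
import HarnessLib

/-!
# The 0-form gap `4 sin²(π/(Nℓ))` of the covariant Laplacian at a twist-eating ladder, on the whole `Fin` box `ℓ × ℓ × L × T`

HELPER toward stub **T1** `TwistedSlabAnchor` (LINE `twisted-slab-continuity`, crux `IRcof` stmt-QuantumFields-26930, census row 43;
LEAD prover ym-ir-line-tsc-p1 g3; `--supports` the crux, `--as helper`).  Third file of the HOME HANDOFF item K3 («transversal
non-degeneracy of the classical vacua IN T1's OWN CURRENCY»): the 0-FORM INPUT of `coulomb_gap_of_zeroForm_gap`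
(`…TwistedSlabWeitzenboeck`) at the ladder backgrounds of `…TwistedSlabVacuumOrbits`, obtained from lit-4's twisted-periodic
`twistedTorus_poincare_sharp` (p657165) by an explicit DICTIONARY.
* §1 the sheet-crossing count `σ i = ⌈i/ℓ⌉ = (i + m)/(m + 1)` (`ℓ = m + 1`): `σ (i + ℓ) = σ i + 1`, and `σ (i+1) = σ i` unless `i ≡ 0 (mod ℓ)`
  where it jumps by one (`sheetCount_add_period`, `sheetCount_succ`) — the twisted link of the ladder (`ladderField`, previous file) sits between
  the coordinates `0` and `1`.
* §2 ★ the DICTIONARY on a twisted slice `x₂ = c, x₃ = d`: `unroll A B Φ c d i j = W_{ij} Φ(i, j, c, d) W_{ij}ᴴ`, `W_{ij} = A^{σ i}B^{σ j}`, is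
  TWISTED-PERIODIC (`unroll_add_period_fst ∕ _snd`: `Φ̃(i+ℓ,j) = AΦ̃A†`, `Φ̃(i,j+ℓ) = BΦ̃B†`), traceless if `Φ` is, has the same sitewise
  Hilbert–Schmidt mass, and its PLAIN forward differences are unitary conjugates of the LADDER-COVARIANT differences `∇⁺_0Φ`, `∇⁺_1Φ`
  (`unroll_succ_fst_sub`, `unroll_succ_snd_sub`).
* §3 ★★ `zeroForm_gap_ladder`: for a unitary Weyl pair `AB = ω·BA` (`ω` a primitive `N`-th root of unity), ANY unitary `Γ₂, Γ₃`, every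
  box `(m+1) × (m+1) × n₂ × n₃` and every TRACELESS site field `Φ`:
  `4 sin²(π/(N(m+1))) · Σ_x S(Φ x) ≤ Σ_x (S(∇⁺_0 Φ)(x) + S(∇⁺_1 Φ)(x)) ≤ Σ_x Σ_μ S(∇⁺_μ Φ)(x)` — the adjoint covariant Laplacian at the
  twist-eating ladder has NO ZERO MODE on `su(N)`-valued fields and gap the square of the smallest twisted momentum, UNIFORMLY in the
  long extents `n₂, n₃` (they only add non-negative terms) [GPGAO 2014 §3: «momentum quantized in units of `2π/(N l_μ)` … excluding zero»].
  Corollary `eq_zero_of_covDeriv_ladder_eq_zero`: NO INFINITESIMAL GAUGE ZERO MODES at the eater (a traceless `Φ` with `∇⁺Φ = 0` vanishes —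
  the linearisation of K2's «stabiliser `= Z_N`»; the Faddeev–Popov operator is invertible).
The Coulomb-gauge 1-form gap and its identification with the Hessian of the T1 integrand's exponent follow in `…TwistedSlabHessian`.

HONEST FRAMING: tree-level linear algebra on one box; nothing here is an estimate on the Wilson measure, nothing uniform in `β`;
T1-box 0∕1, T1 proper 0∕1; nothing bears on `IRcof`, `IR`, or the Yang–Mills mass gap (Clay: NOT proved); R4 = `BalabanLadder.UV` only.
References: M. García Pérez, A. González-Arroyo, M. Okawa, IJMPA 29 (2014) 1445001 §3; JHEP 10 (2017) 150 §2.2–2.3 (twist eaters as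
transition functions vs. as a zero-action lattice field: the dictionary of §3); A. González-Arroyo, C. P. Korthals Altes, NPB 311 (1988) 433.
-/

set_option autoImplicit false

noncomputable section

open scoped Matrix
open Finset
open Literature.MathematicalPhysics.QuantumFieldTheory Literature.MathematicalPhysics.QuantumLattice

namespace Summit.QuantumFields.YangMills.Cruxes.IRcof.TwistedSlab

variable {N : ℕ}

/-! ## §1 The sheet-crossing count `σ i = ⌈i/ℓ⌉` -/

section Sigma

/-- The number of sheet links `0 → 1 (mod ℓ)` crossed by the path `0 → 1 → ⋯ → i`, `ℓ = m + 1`: `σ i = ⌈i / ℓ⌉ = (i + m) / (m + 1)`. [folklore] -/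
def sheetCount (m i : ℕ) : ℕ := (i + m) / (m + 1)

/-- `σ 0 = 0`. [folklore] -/
theorem sheetCount_zero (m : ℕ) : sheetCount m 0 = 0 := by
  unfold sheetCount; exact Nat.div_eq_of_lt (by omega)

/-- One full period crosses one more sheet: `σ (i + ℓ) = σ i + 1`. [folklore] -/
theorem sheetCount_add_period (m i : ℕ) : sheetCount m (i + (m + 1)) = sheetCount m i + 1 := by
  unfold sheetCount
  rw [show i + (m + 1) + m = (i + m) + (m + 1) by ring, Nat.add_div_right _ (Nat.succ_pos m)]

/-- **The count jumps exactly at the sheet**: `σ (i + 1) = σ i + 1` if `i ≡ 0 (mod ℓ)`, `σ (i + 1) = σ i` otherwise. [folklore] -/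
theorem sheetCount_succ (m i : ℕ) : sheetCount m (i + 1) = sheetCount m i + if i % (m + 1) = 0 then 1 else 0 := by
  unfold sheetCount
  have hℓ : 0 < m + 1 := Nat.succ_pos m
  set q := i / (m + 1) with hq
  set r := i % (m + 1) with hr
  have hi : i = r + q * (m + 1) := by rw [hr, hq, mul_comm]; exact (Nat.mod_add_div i (m + 1)).symm
  have hrl : r < m + 1 := Nat.mod_lt _ hℓ
  have e1 : (i + m) / (m + 1) = (r + m) / (m + 1) + q := by
    rw [hi, show r + q * (m + 1) + m = (r + m) + q * (m + 1) by ring, Nat.add_mul_div_right _ _ hℓ]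
  have e2 : (i + 1 + m) / (m + 1) = (r + 1 + m) / (m + 1) + q := by
    rw [hi, show r + q * (m + 1) + 1 + m = (r + 1 + m) + q * (m + 1) by ring, Nat.add_mul_div_right _ _ hℓ]
  rw [e1, e2]
  by_cases h : r = 0
  · rw [if_pos h, h]
    simp only [Nat.zero_add]
    rw [Nat.div_eq_of_lt (by omega : m < m + 1), show 1 + m = m + 1 from Nat.add_comm 1 m, Nat.div_self hℓ]
    ring
  · rw [if_neg h, Nat.div_eq_of_lt_le (k := 1) (by omega) (by omega), Nat.div_eq_of_lt_le (k := 1) (by omega) (by omega)]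
    ring

end Sigma

/-! ## §2 The dictionary: unrolling a site field along a twisted slice -/

section Unroll

open Fin.NatCast

variable {m n₂ n₃ : ℕ} (A B : Matrix (Fin N) (Fin N) ℂ)

/-- The site `(i, j, c, d)` of the box `(m+1) × (m+1) × n₂ × n₃`, first two coordinates read modulo `m + 1`. [folklore] -/
def sliceSite (c : Fin n₂) (d : Fin n₃) (i j : ℕ) : FinTorusSite (m + 1) (m + 1) n₂ n₃ :=
  ((i : Fin (m + 1)), (j : Fin (m + 1)), c, d)

/-- The transition matrix `W_{ij} = A^{σ i} B^{σ j}` accumulated along the path to `(i, j)`. [folklore] -/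
def unrollTrans (m : ℕ) (i j : ℕ) : Matrix (Fin N) (Fin N) ℂ := A ^ sheetCount m i * B ^ sheetCount m j

/-- **The unrolled field** `Φ̃(i, j) = W_{ij} · Φ(i, j, c, d) · W_{ij}ᴴ` of a site field `Φ` along the twisted slice `(x₂, x₃) = (c, d)` — the
transition-function picture of García Pérez–González-Arroyo–Okawa for the zero-action LATTICE FIELD picture of the ladder. [folklore;
García Pérez–González-Arroyo–Okawa 2017 §2.2–2.3] -/
def unroll (Φ : FinTorusSite (m + 1) (m + 1) n₂ n₃ → Matrix (Fin N) (Fin N) ℂ) (c : Fin n₂) (d : Fin n₃) (i j : ℕ) :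
    Matrix (Fin N) (Fin N) ℂ :=
  unrollTrans A B m i j * Φ (sliceSite c d i j) * (unrollTrans A B m i j)ᴴ

variable {A B}

/-- Shifting the slice site in direction `0` adds one to `i`. [folklore] -/
theorem sliceSite_shift_zero (c : Fin n₂) (d : Fin n₃) (i j : ℕ) :
    (sliceSite (m := m) c d i j).shift 0 = sliceSite c d (i + 1) j := by
  simp [sliceSite, FinTorusSite.shift, Nat.cast_succ]

/-- Shifting the slice site in direction `1` adds one to `j`. [folklore] -/
theorem sliceSite_shift_one (c : Fin n₂) (d : Fin n₃) (i j : ℕ) :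
    (sliceSite (m := m) c d i j).shift 1 = sliceSite c d i (j + 1) := by
  simp [sliceSite, FinTorusSite.shift, Nat.cast_succ]

/-- A full period in `i` or `j` returns to the same site. [folklore] -/
theorem sliceSite_add_period (c : Fin n₂) (d : Fin n₃) (i j : ℕ) :
    sliceSite (m := m) c d (i + (m + 1)) j = sliceSite c d i j ∧ sliceSite (m := m) c d i (j + (m + 1)) = sliceSite c d i j := by
  constructor <;> simp [sliceSite, Nat.cast_add]

/-- Coordinates `0` and `1` of the slice site: `i % ℓ` and `j % ℓ`. [folklore] -/
theorem finTorusSiteCoord_sliceSite (c : Fin n₂) (d : Fin n₃) (i j : ℕ) :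
    finTorusSiteCoord (sliceSite (m := m) c d i j) 0 = i % (m + 1) ∧ finTorusSiteCoord (sliceSite (m := m) c d i j) 1 = j % (m + 1) := by
  unfold finTorusSiteCoord sliceSite
  simp

/-- `A^a B = ω^a · B A^a` for a Weyl pair `AB = ω·BA`. [folklore] -/
theorem pow_mul_eq_smul_mul_pow {ω : ℂ} (hAB : A * B = ω • (B * A)) (a : ℕ) :
    A ^ a * B = ω ^ a • (B * A ^ a) := by
  induction a with
  | zero => simp
  | succ a ih =>
    rw [pow_succ', Matrix.mul_assoc, ih, Matrix.mul_smul, ← Matrix.mul_assoc, hAB, Matrix.smul_mul, smul_smul,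
      Matrix.mul_assoc, ← pow_succ ω a, ← pow_succ' A a]

/-- `A B^b = ω^b · B^b A` for a Weyl pair `AB = ω·BA`. [folklore] -/
theorem mul_pow_eq_smul_pow_mul {ω : ℂ} (hAB : A * B = ω • (B * A)) (b : ℕ) :
    A * B ^ b = ω ^ b • (B ^ b * A) := by
  induction b with
  | zero => simp
  | succ b ih =>
    rw [pow_succ, ← Matrix.mul_assoc, ih, Matrix.smul_mul, Matrix.mul_assoc, hAB, Matrix.mul_smul, smul_smul,
      ← Matrix.mul_assoc, ← pow_succ B b, ← pow_succ ω b]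

section Steps

variable {ω : ℂ} (hAB : A * B = ω • (B * A))
include hAB

/-- Period in `i`: `W_{i+ℓ, j} = A · W_{ij}`. [folklore] -/
theorem unrollTrans_add_period_fst (i j : ℕ) : unrollTrans A B m (i + (m + 1)) j = A * unrollTrans A B m i j := by
  have _ := hAB
  simp only [unrollTrans, sheetCount_add_period, pow_succ', Matrix.mul_assoc]

/-- Period in `j`: `W_{i, j+ℓ} = ω^{σ i} · B · W_{ij}`. [folklore] -/
theorem unrollTrans_add_period_snd (i j : ℕ) :
    unrollTrans A B m i (j + (m + 1)) = ω ^ sheetCount m i • (B * unrollTrans A B m i j) := by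
  simp only [unrollTrans, sheetCount_add_period]
  rw [pow_succ' B, ← Matrix.mul_assoc, pow_mul_eq_smul_mul_pow hAB, Matrix.smul_mul, Matrix.mul_assoc]

/-- Off the sheet in `i`: `W_{i+1, j} = W_{ij}`. [folklore] -/
theorem unrollTrans_succ_fst_of_ne (i j : ℕ) (hi : i % (m + 1) ≠ 0) : unrollTrans A B m (i + 1) j = unrollTrans A B m i j := by
  have _ := hAB
  simp only [unrollTrans, sheetCount_succ, if_neg hi, add_zero]

/-- At the sheet in `i`: `W_{i+1, j} = ω^{σ j} · W_{ij} · A`. [folklore] -/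
theorem unrollTrans_succ_fst_of_eq (i j : ℕ) (hi : i % (m + 1) = 0) :
    unrollTrans A B m (i + 1) j = ω ^ sheetCount m j • (unrollTrans A B m i j * A) := by
  simp only [unrollTrans, sheetCount_succ, if_pos hi]
  rw [pow_succ, Matrix.mul_assoc, mul_pow_eq_smul_pow_mul hAB, Matrix.mul_smul, Matrix.mul_assoc]

/-- Off the sheet in `j`: `W_{i, j+1} = W_{ij}`. [folklore] -/
theorem unrollTrans_succ_snd_of_ne (i j : ℕ) (hj : j % (m + 1) ≠ 0) : unrollTrans A B m i (j + 1) = unrollTrans A B m i j := by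
  have _ := hAB
  simp only [unrollTrans, sheetCount_succ, if_neg hj, add_zero]

/-- At the sheet in `j`: `W_{i, j+1} = W_{ij} · B`. [folklore] -/
theorem unrollTrans_succ_snd_of_eq (i j : ℕ) (hj : j % (m + 1) = 0) : unrollTrans A B m i (j + 1) = unrollTrans A B m i j * B := by
  have _ := hAB
  simp only [unrollTrans, sheetCount_succ, if_pos hj, pow_succ, Matrix.mul_assoc]

end Steps

/-- The transition matrices are unitary. [folklore] -/
theorem unrollTrans_mem_unitaryGroup (hAu : A ∈ Matrix.unitaryGroup (Fin N) ℂ) (hBu : B ∈ Matrix.unitaryGroup (Fin N) ℂ) (i j : ℕ) :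
    unrollTrans A B m i j ∈ Matrix.unitaryGroup (Fin N) ℂ :=
  Submonoid.mul_mem _ (Submonoid.pow_mem _ hAu _) (Submonoid.pow_mem _ hBu _)

/-- Conjugation by a phase multiple of a product: `(c·WV) Φ (c·WV)ᴴ = W (V Φ Vᴴ) Wᴴ` for `|c| = 1`. [folklore] -/
theorem smul_mul_conj_eq {c : ℂ} (hc : star c * c = 1) (W V Φ : Matrix (Fin N) (Fin N) ℂ) :
    (c • (W * V)) * Φ * (c • (W * V))ᴴ = W * (V * Φ * Vᴴ) * Wᴴ := by
  have hc' : c * star c = 1 := by rw [mul_comm]; exact hc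
  rw [Matrix.conjTranspose_smul, Matrix.smul_mul, Matrix.smul_mul, Matrix.mul_smul, smul_smul, hc', one_smul,
    Matrix.conjTranspose_mul]
  simp only [Matrix.mul_assoc]

variable {Φ : FinTorusSite (m + 1) (m + 1) n₂ n₃ → Matrix (Fin N) (Fin N) ℂ} {c : Fin n₂} {d : Fin n₃} {ω : ℂ}

/-- ★ **Twisted periodicity in `i`**: `Φ̃(i + ℓ, j) = A Φ̃(i, j) Aᴴ`. [folklore; GPGAO 2014 §3 (twisted boundary conditions for adjoint fields)] -/
theorem unroll_add_period_fst (hAB : A * B = ω • (B * A)) (i j : ℕ) :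
    unroll A B Φ c d (i + (m + 1)) j = A * unroll A B Φ c d i j * Aᴴ := by
  simp only [unroll, unrollTrans_add_period_fst hAB, (sliceSite_add_period c d i j).1, Matrix.conjTranspose_mul]
  simp only [Matrix.mul_assoc]

/-- ★ **Twisted periodicity in `j`**: `Φ̃(i, j + ℓ) = B Φ̃(i, j) Bᴴ` (the Weyl phase cancels: `|ω| = 1`). [folklore; GPGAO 2014 §3] -/
theorem unroll_add_period_snd (hω : star ω * ω = 1) (hAB : A * B = ω • (B * A)) (i j : ℕ) :
    unroll A B Φ c d i (j + (m + 1)) = B * unroll A B Φ c d i j * Bᴴ := by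
  simp only [unroll, unrollTrans_add_period_snd hAB, (sliceSite_add_period c d i j).2]
  rw [smul_mul_conj_eq (star_pow_mul_pow hω _)]

/-- The unrolled field of a traceless field is traceless. [folklore] -/
theorem trace_unroll (hAu : A ∈ Matrix.unitaryGroup (Fin N) ℂ) (hBu : B ∈ Matrix.unitaryGroup (Fin N) ℂ)
    (htr : ∀ x, (Φ x).trace = 0) (i j : ℕ) : (unroll A B Φ c d i j).trace = 0 := by
  have hW : (unrollTrans A B m i j)ᴴ * unrollTrans A B m i j = 1 := (unrollTrans_mem_unitaryGroup hAu hBu i j).1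
  rw [unroll, Matrix.trace_mul_cycle, hW, Matrix.one_mul, htr]

/-- The unrolled field has the same sitewise Hilbert–Schmidt mass. [folklore] -/
theorem hsS_unroll (hAu : A ∈ Matrix.unitaryGroup (Fin N) ℂ) (hBu : B ∈ Matrix.unitaryGroup (Fin N) ℂ) (i j : ℕ) :
    (((unroll A B Φ c d i j)ᴴ * unroll A B Φ c d i j).trace).re =
      (((Φ (sliceSite c d i j))ᴴ * Φ (sliceSite c d i j)).trace).re :=
  re_trace_conjTranspose_mul_self_conj (unrollTrans_mem_unitaryGroup hAu hBu i j).1 _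

/-- ★ **Plain differences of the unrolled field = conjugated LADDER-covariant differences, direction `0`**:
`Φ̃(i+1, j) − Φ̃(i, j) = W_{ij} · (∇⁺_0 Φ)(i, j, c, d) · W_{ij}ᴴ` for the ladder `![A, B, Γ₂, Γ₃]`. [folklore; GPGAO 2017 §2.3] -/
theorem unroll_succ_fst_sub (hω : star ω * ω = 1) (hAB : A * B = ω • (B * A)) (Γ₂ Γ₃ : Matrix (Fin N) (Fin N) ℂ) (i j : ℕ) :
    unroll A B Φ c d (i + 1) j - unroll A B Φ c d i j =
      unrollTrans A B m i j * covDeriv (ladderField ![A, B, Γ₂, Γ₃]) 0 Φ (sliceSite c d i j) * (unrollTrans A B m i j)ᴴ := by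
  rw [covDeriv_apply, ladderField_apply, (finTorusSiteCoord_sliceSite c d i j).1, sliceSite_shift_zero]
  simp only [Matrix.cons_val_zero]
  by_cases hi : i % (m + 1) = 0
  · rw [if_pos hi, unroll, unroll, unrollTrans_succ_fst_of_eq hAB i j hi, smul_mul_conj_eq (star_pow_mul_pow hω _),
      Matrix.mul_sub, Matrix.sub_mul]
  · rw [if_neg hi, unroll, unroll, unrollTrans_succ_fst_of_ne hAB i j hi, Matrix.one_mul, Matrix.conjTranspose_one,
      Matrix.mul_one, Matrix.mul_sub, Matrix.sub_mul]

/-- ★ **Direction `1`**: `Φ̃(i, j+1) − Φ̃(i, j) = W_{ij} · (∇⁺_1 Φ)(i, j, c, d) · W_{ij}ᴴ`. [folklore; GPGAO 2017 §2.3] -/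
theorem unroll_succ_snd_sub (hAB : A * B = ω • (B * A)) (Γ₂ Γ₃ : Matrix (Fin N) (Fin N) ℂ) (i j : ℕ) :
    unroll A B Φ c d i (j + 1) - unroll A B Φ c d i j =
      unrollTrans A B m i j * covDeriv (ladderField ![A, B, Γ₂, Γ₃]) 1 Φ (sliceSite c d i j) * (unrollTrans A B m i j)ᴴ := by
  rw [covDeriv_apply, ladderField_apply, (finTorusSiteCoord_sliceSite c d i j).2, sliceSite_shift_one]
  simp only [Matrix.cons_val_one, Matrix.cons_val_zero]
  by_cases hj : j % (m + 1) = 0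
  · rw [if_pos hj, unroll, unroll, unrollTrans_succ_snd_of_eq hAB i j hj, Matrix.conjTranspose_mul, Matrix.mul_sub,
      Matrix.sub_mul]
    simp only [Matrix.mul_assoc]
  · rw [if_neg hj, unroll, unroll, unrollTrans_succ_snd_of_ne hAB i j hj, Matrix.one_mul, Matrix.conjTranspose_one,
      Matrix.mul_one, Matrix.mul_sub, Matrix.sub_mul]

end Unroll

/-! ## §3 The 0-form gap at the ladder on the whole box -/

section Gap

open Fin.NatCast

variable [NeZero N] {m n₂ n₃ : ℕ} {A B : Matrix (Fin N) (Fin N) ℂ} {ω : ℂ}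

/-- `Σ_{i<ℓ} g(i mod ℓ) = Σ_{a : Fin ℓ} g a`. [folklore] -/
theorem sum_range_natCast_eq {M : Type*} [AddCommMonoid M] (g : Fin (m + 1) → M) :
    ∑ i ∈ range (m + 1), g (i : Fin (m + 1)) = ∑ a : Fin (m + 1), g a := by
  rw [← Fin.sum_univ_eq_sum_range (fun i : ℕ => g (i : Fin (m + 1))) (m + 1)]
  simp only [Fin.cast_val_eq_self]

/-- Reordering a fourfold sum: `Σ_a Σ_b Σ_c Σ_d = Σ_c Σ_d Σ_a Σ_b`. [folklore] -/
theorem sum_comm_four {α β γ δ : Type*} [Fintype α] [Fintype β] [Fintype γ] [Fintype δ] (F : α → β → γ → δ → ℝ) :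
    ∑ a, ∑ b, ∑ c, ∑ d, F a b c d = ∑ c, ∑ d, ∑ a, ∑ b, F a b c d := by
  calc ∑ a, ∑ b, ∑ c, ∑ d, F a b c d = ∑ a, ∑ c, ∑ b, ∑ d, F a b c d :=
        Finset.sum_congr rfl fun a _ => Finset.sum_comm
    _ = ∑ c, ∑ a, ∑ b, ∑ d, F a b c d := Finset.sum_comm
    _ = ∑ c, ∑ a, ∑ d, ∑ b, F a b c d :=
        Finset.sum_congr rfl fun c _ => Finset.sum_congr rfl fun a _ => Finset.sum_comm
    _ = ∑ c, ∑ d, ∑ a, ∑ b, F a b c d := Finset.sum_congr rfl fun c _ => Finset.sum_comm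

/-- ★ **The 0-form gap on one twisted slice** `(x₂, x₃) = (c, d)` of the ladder `![A, B, Γ₂, Γ₃]`: for traceless `Φ`,
`4 sin²(π/(Nℓ)) · Σ_{a,b} S(Φ(a,b,c,d)) ≤ Σ_{a,b} [S(∇⁺_0Φ) + S(∇⁺_1Φ)](a,b,c,d)` — lit-4's `twistedTorus_poincare_sharp` transported through the
dictionary of §3. [cite: GarciaperezGonzalezarroyoOkawa2014, §3 (momentum quantized in units of `2π/(N l_μ)`, excluding zero)] -/
theorem zeroForm_gap_ladder_slice (hAu : A ∈ Matrix.unitaryGroup (Fin N) ℂ) (hBu : B ∈ Matrix.unitaryGroup (Fin N) ℂ)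
    (hω : IsPrimitiveRoot ω N) (hAB : A * B = ω • (B * A)) (Γ₂ Γ₃ : Matrix (Fin N) (Fin N) ℂ)
    {Φ : FinTorusSite (m + 1) (m + 1) n₂ n₃ → Matrix (Fin N) (Fin N) ℂ} (htr : ∀ x, (Φ x).trace = 0) (c : Fin n₂) (d : Fin n₃) :
    4 * Real.sin (Real.pi / ((N : ℝ) * (m + 1 : ℕ))) ^ 2 * ∑ a : Fin (m + 1), ∑ b : Fin (m + 1), (((Φ (a, b, c, d))ᴴ * Φ (a, b, c, d)).trace).re ≤
      ∑ a : Fin (m + 1), ∑ b : Fin (m + 1),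
        ((((covDeriv (ladderField ![A, B, Γ₂, Γ₃]) 0 Φ (a, b, c, d))ᴴ * covDeriv (ladderField ![A, B, Γ₂, Γ₃]) 0 Φ (a, b, c, d)).trace).re +
          (((covDeriv (ladderField ![A, B, Γ₂, Γ₃]) 1 Φ (a, b, c, d))ᴴ * covDeriv (ladderField ![A, B, Γ₂, Γ₃]) 1 Φ (a, b, c, d)).trace).re) := by
  have hωs : star ω * ω = 1 := star_mul_self_of_pow_eq_one (NeZero.ne N) hω.pow_eq_one
  have h := twistedTorus_poincare_sharp (ℓ := m + 1) (Φ := unroll A B Φ c d) hAu hBu hω hAB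
    (unroll_add_period_fst hAB) (unroll_add_period_snd hωs hAB) (trace_unroll hAu hBu htr)
  -- rewrite the window sums of the unrolled field as box-slice sums of `Φ`
  have hW : ∀ i j, (unrollTrans A B m i j)ᴴ * unrollTrans A B m i j = 1 := fun i j => (unrollTrans_mem_unitaryGroup hAu hBu i j).1
  have hmass : ∑ i ∈ range (m + 1), ∑ j ∈ range (m + 1), (((unroll A B Φ c d i j)ᴴ * unroll A B Φ c d i j).trace).re =
      ∑ a : Fin (m + 1), ∑ b : Fin (m + 1), (((Φ (a, b, c, d))ᴴ * Φ (a, b, c, d)).trace).re := by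
    simp only [hsS_unroll hAu hBu, sliceSite]
    rw [sum_range_natCast_eq (fun a => ∑ j ∈ range (m + 1), (((Φ (a, (j : Fin (m + 1)), c, d))ᴴ * Φ (a, (j : Fin (m + 1)), c, d)).trace).re)]
    exact Finset.sum_congr rfl fun a _ => sum_range_natCast_eq (fun b => (((Φ (a, b, c, d))ᴴ * Φ (a, b, c, d)).trace).re)
  have hdiff : ∑ i ∈ range (m + 1), ∑ j ∈ range (m + 1),
      ((((unroll A B Φ c d (i + 1) j - unroll A B Φ c d i j)ᴴ * (unroll A B Φ c d (i + 1) j - unroll A B Φ c d i j)).trace).re +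
        (((unroll A B Φ c d i (j + 1) - unroll A B Φ c d i j)ᴴ * (unroll A B Φ c d i (j + 1) - unroll A B Φ c d i j)).trace).re) =
      ∑ a : Fin (m + 1), ∑ b : Fin (m + 1),
        ((((covDeriv (ladderField ![A, B, Γ₂, Γ₃]) 0 Φ (a, b, c, d))ᴴ * covDeriv (ladderField ![A, B, Γ₂, Γ₃]) 0 Φ (a, b, c, d)).trace).re +
          (((covDeriv (ladderField ![A, B, Γ₂, Γ₃]) 1 Φ (a, b, c, d))ᴴ * covDeriv (ladderField ![A, B, Γ₂, Γ₃]) 1 Φ (a, b, c, d)).trace).re) := by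
    simp only [unroll_succ_fst_sub hωs hAB Γ₂ Γ₃, unroll_succ_snd_sub hAB Γ₂ Γ₃, re_trace_conjTranspose_mul_self_conj (hW _ _),
      sliceSite]
    rw [sum_range_natCast_eq (fun a => ∑ j ∈ range (m + 1),
      ((((covDeriv (ladderField ![A, B, Γ₂, Γ₃]) 0 Φ (a, (j : Fin (m + 1)), c, d))ᴴ *
          covDeriv (ladderField ![A, B, Γ₂, Γ₃]) 0 Φ (a, (j : Fin (m + 1)), c, d)).trace).re +
        (((covDeriv (ladderField ![A, B, Γ₂, Γ₃]) 1 Φ (a, (j : Fin (m + 1)), c, d))ᴴ *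
          covDeriv (ladderField ![A, B, Γ₂, Γ₃]) 1 Φ (a, (j : Fin (m + 1)), c, d)).trace).re))]
    exact Finset.sum_congr rfl fun a _ => sum_range_natCast_eq (fun b =>
      ((((covDeriv (ladderField ![A, B, Γ₂, Γ₃]) 0 Φ (a, b, c, d))ᴴ * covDeriv (ladderField ![A, B, Γ₂, Γ₃]) 0 Φ (a, b, c, d)).trace).re +
        (((covDeriv (ladderField ![A, B, Γ₂, Γ₃]) 1 Φ (a, b, c, d))ᴴ * covDeriv (ladderField ![A, B, Γ₂, Γ₃]) 1 Φ (a, b, c, d)).trace).re))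
  rw [hmass, hdiff] at h
  exact h

/-- ★★ **THE 0-FORM GAP AT THE TWIST-EATING LADDER ON THE WHOLE BOX.**  For a unitary Weyl pair `AB = ω·BA` (`ω` a primitive `N`-th root of
unity), ANY `Γ₂, Γ₃`, every box `(m+1) × (m+1) × n₂ × n₃` and every TRACELESS site field `Φ`:
`4 sin²(π/(N(m+1))) · Σ_x S(Φ x) ≤ Σ_x (S(∇⁺_0 Φ)(x) + S(∇⁺_1 Φ)(x))` — the covariant Laplacian of the two TWISTED directions alone already has
no zero mode on `su(N)`-valued fields, with the sharp constant, uniformly in the long extents `n₂, n₃`.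
[cite: GarciaperezGonzalezarroyoOkawa2014, §3] -/
theorem zeroForm_gap_ladder_twisted (hAu : A ∈ Matrix.unitaryGroup (Fin N) ℂ) (hBu : B ∈ Matrix.unitaryGroup (Fin N) ℂ)
    (hω : IsPrimitiveRoot ω N) (hAB : A * B = ω • (B * A)) (Γ₂ Γ₃ : Matrix (Fin N) (Fin N) ℂ)
    {Φ : FinTorusSite (m + 1) (m + 1) n₂ n₃ → Matrix (Fin N) (Fin N) ℂ} (htr : ∀ x, (Φ x).trace = 0) :
    4 * Real.sin (Real.pi / ((N : ℝ) * (m + 1 : ℕ))) ^ 2 * ∑ x, (((Φ x)ᴴ * Φ x).trace).re ≤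
      ∑ x, ((((covDeriv (ladderField ![A, B, Γ₂, Γ₃]) 0 Φ x)ᴴ * covDeriv (ladderField ![A, B, Γ₂, Γ₃]) 0 Φ x).trace).re +
        (((covDeriv (ladderField ![A, B, Γ₂, Γ₃]) 1 Φ x)ᴴ * covDeriv (ladderField ![A, B, Γ₂, Γ₃]) 1 Φ x).trace).re) := by
  -- reorder the box sum as `Σ_c Σ_d Σ_a Σ_b` and apply the slice inequality
  have hre : ∀ F : FinTorusSite (m + 1) (m + 1) n₂ n₃ → ℝ,
      ∑ x, F x = ∑ c : Fin n₂, ∑ d : Fin n₃, ∑ a : Fin (m + 1), ∑ b : Fin (m + 1), F (a, b, c, d) := by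
    intro F
    simp only [Fintype.sum_prod_type]
    exact sum_comm_four (fun a b c d => F (a, b, c, d))
  rw [hre, hre, Finset.mul_sum]
  refine Finset.sum_le_sum fun c _ => ?_
  rw [Finset.mul_sum]
  refine Finset.sum_le_sum fun d _ => ?_
  exact zeroForm_gap_ladder_slice hAu hBu hω hAB Γ₂ Γ₃ htr c d

/-- ★★ **The 0-form gap in the currency of `coulomb_gap_of_zeroForm_gap`**: all four directions on the right (the long ones only add
non-negative terms). [cite: GarciaperezGonzalezarroyoOkawa2014, §3] -/
theorem zeroForm_gap_ladder (hAu : A ∈ Matrix.unitaryGroup (Fin N) ℂ) (hBu : B ∈ Matrix.unitaryGroup (Fin N) ℂ)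
    (hω : IsPrimitiveRoot ω N) (hAB : A * B = ω • (B * A)) (Γ₂ Γ₃ : Matrix (Fin N) (Fin N) ℂ)
    (Φ : FinTorusSite (m + 1) (m + 1) n₂ n₃ → Matrix (Fin N) (Fin N) ℂ) (htr : ∀ x, (Φ x).trace = 0) :
    4 * Real.sin (Real.pi / ((N : ℝ) * (m + 1 : ℕ))) ^ 2 * ∑ x, (((Φ x)ᴴ * Φ x).trace).re ≤
      ∑ x, ∑ μ, (((covDeriv (ladderField ![A, B, Γ₂, Γ₃]) μ Φ x)ᴴ * covDeriv (ladderField ![A, B, Γ₂, Γ₃]) μ Φ x).trace).re := by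
  refine (zeroForm_gap_ladder_twisted hAu hBu hω hAB Γ₂ Γ₃ htr).trans (Finset.sum_le_sum fun x _ => ?_)
  rw [Fin.sum_univ_four]
  have h2 := re_trace_conjTranspose_mul_self_nonneg (covDeriv (ladderField ![A, B, Γ₂, Γ₃]) 2 Φ x)
  have h3 := re_trace_conjTranspose_mul_self_nonneg (covDeriv (ladderField ![A, B, Γ₂, Γ₃]) 3 Φ x)
  linarith

omit [NeZero N] in
/-- `S(X) = 0` forces `X = 0` (the Hilbert–Schmidt form is definite). [folklore] -/
theorem eq_zero_of_hsS_eq_zero {X : Matrix (Fin N) (Fin N) ℂ} (h : ((Xᴴ * X).trace).re = 0) : X = 0 := by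
  rw [re_trace_conjTranspose_mul_self_eq_sum] at h
  ext i j
  have hi := (Finset.sum_eq_zero_iff_of_nonneg (fun i _ => Finset.sum_nonneg fun j _ => sq_nonneg _)).1 h i (Finset.mem_univ _)
  have hij := (Finset.sum_eq_zero_iff_of_nonneg (fun j _ => sq_nonneg _)).1 hi j (Finset.mem_univ _)
  simpa using hij

/-- ★ **No infinitesimal gauge zero modes at the twist eater** (linearisation of «stabiliser of the ladder = `Z_N`»,
`gaugeAct_ladder_pair_eq_self_iff_specialUnitary`): for `N(m+1) ≥ 2`, a TRACELESS site field with `∇⁺_μ Φ = 0` in all four directions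
vanishes — the linearised gauge-orbit map `Φ ↦ (∇⁺_μ Φ)_μ` at the ladder is injective on `su(N)`-valued fields, so the Faddeev–Popov
operator `Σ_μ ∇⁺_μ†∇⁺_μ` is invertible there. [cite: GarciaperezGonzalezarroyoOkawa2017, §2.2 («the irreducibility condition eliminates the
presence of zero-modes»)] -/
theorem eq_zero_of_covDeriv_ladder_eq_zero (hAu : A ∈ Matrix.unitaryGroup (Fin N) ℂ) (hBu : B ∈ Matrix.unitaryGroup (Fin N) ℂ)
    (hω : IsPrimitiveRoot ω N) (hAB : A * B = ω • (B * A)) (Γ₂ Γ₃ : Matrix (Fin N) (Fin N) ℂ) (hNm : 2 ≤ N * (m + 1))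
    {Φ : FinTorusSite (m + 1) (m + 1) n₂ n₃ → Matrix (Fin N) (Fin N) ℂ} (htr : ∀ x, (Φ x).trace = 0)
    (hflat : ∀ μ x, covDeriv (ladderField ![A, B, Γ₂, Γ₃]) μ Φ x = 0) : Φ = 0 := by
  have h := zeroForm_gap_ladder hAu hBu hω hAB Γ₂ Γ₃ Φ htr
  simp only [hflat, Matrix.conjTranspose_zero, Matrix.mul_zero, Matrix.trace_zero, Complex.zero_re, Finset.sum_const_zero] at h
  have hsin : 0 < Real.sin (Real.pi / ((N : ℝ) * (m + 1 : ℕ))) := by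
    have hd : (1 : ℝ) < (N : ℝ) * (m + 1 : ℕ) := by exact_mod_cast hNm
    refine Real.sin_pos_of_pos_of_lt_pi (div_pos Real.pi_pos (by linarith)) ?_
    rw [div_lt_iff₀ (by linarith)]
    nlinarith [Real.pi_pos]
  have hsum : ∑ x, (((Φ x)ᴴ * Φ x).trace).re ≤ 0 := by
    by_contra hpos
    push Not at hpos
    have : 0 < 4 * Real.sin (Real.pi / ((N : ℝ) * (m + 1 : ℕ))) ^ 2 * ∑ x, (((Φ x)ᴴ * Φ x).trace).re := by positivity
    linarith
  have hzero : ∑ x, (((Φ x)ᴴ * Φ x).trace).re = 0 :=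
    le_antisymm hsum (Finset.sum_nonneg fun x _ => re_trace_conjTranspose_mul_self_nonneg _)
  funext x
  exact eq_zero_of_hsS_eq_zero
    ((Finset.sum_eq_zero_iff_of_nonneg fun y _ => re_trace_conjTranspose_mul_self_nonneg (Φ y)).1 hzero x (Finset.mem_univ _))

end Gap

end Summit.QuantumFields.YangMills.Cruxes.IRcof.TwistedSlab

end
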